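import Literature.MathematicalPhysics.KineticTheory.HardSphereCanonicalClusterBound
import HarnessLib

/-!
# A lower bound for the pair law of the canonical hard-sphere gas on `𝕋³` outside the core

Topic `Literature/MathematicalPhysics/KineticTheory` (one-sided companion of `HardSphereCanonicalPairBound` /
`HardSphereCanonicalClusterBound`; the static input of every collision-rate FLOOR at rung 0 — crux `JParityClosure.RateFloor`,
stmt-AtomisticToContinuum-13080, line `Sketch`: the Gibbs mean of Boltzmann's collision-cylinder count is bounded BELOW by a
universal fraction of the ideal-gas one, without the contact theorem).

For `N + 1` hard spheres of diameter `ε_N = hsDiameter σ N` on the unit torus with uniform activity, two labels `i ≠ j`, and a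
measurable set `T ⊆ 𝕋³` of relative positions OUTSIDE the core (`ε_N ≤ ‖reprSym q‖` for `q ∈ T` — e.g. a thin shell just outside
contact, a collision tube), the canonical probability that `x_i − x_j ∈ T` is at least `(1 − 16 λ) · vol(T)`, `λ = v₁ σ³` the
overlap density (`ovDensity uniformProfile σ`), uniformly in `N` and in `T`:

* `pi_hardCore_inter_eq_of_dependsOn` — independence under the product measure: for an event `E` involving only labels in `B`
  and a label set `W` disjoint from `B`, `ℙ^{⊗}(hardCore(W) ∩ E) = Ξ(W) · ℙ^{⊗}(E)` (the equality behind the dropping lemmas of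
  the two companion files);
* `hardCore_pair_sdiff_subset` — keeping the constraints: off the events "`x_k` overlaps `x_i` or `x_j`", `k ∉ {i, j}`, a
  configuration whose other labels are mutually compatible and whose pair `(i, j)` sits in `T` is a hard-core configuration;
* `pi_hardCore_inter_pairEvent_ge` — hence, by a union bound over the third label `k` and the factorisation,
  `Ξ(univ ∖ {i,j}) vol(T) ≤ ℙ^{⊗}(hardCore(univ) ∩ {x_i − x_j ∈ T}) + Σ_k Ξ(univ ∖ {i,j,k}) · 2 vol(T) vol(B_ε)`;
* `posGibbs_pairEvent_ge` — dividing by `Ξ(univ)` (insertion ratios `r_N(N+1,2) ≥ 1`, `r_N(N+1,3) ≤ 8` at small density):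
  `(1 − 16 λ) · vol(T) ≤ posGibbsMeasure 1 ε_N (N+1) {x_i − x_j ∈ T}`; `exists_posGibbs_pairEvent_ge` — in the crux's
  parametrisation, `vol(T) ≤ 2 · posGibbsMeasure … {x_i − x_j ∈ T}` for `σ < σ₀`.

This is the lower half of the two-point Ruelle estimate `ρ₂ ≍ ρ²` near contact for a dilute hard-core gas (the upper half,
`≤ 4 vol(T)`, is `posGibbs_pairEvent_le`); only monotonicity of the hard-core probability and the insertion ratios are used, no
cluster expansion (Ruelle 1969 §4.2; Pulvirenti–Tsagkarogiannis 2012 §3).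

## References
* D. Ruelle, *Statistical Mechanics: Rigorous Results* (1969), §4.2.  [Ruelle1969]
* E. Pulvirenti, D. Tsagkarogiannis, Comm. Math. Phys. 316 (2012) 289–306, §3.  [PulvirentiTsagkarogiannis2012]
-/

noncomputable section

namespace Literature.MathematicalPhysics.KineticTheory

open MeasureTheory ProbabilityTheory Finset Filter Set StatisticalMechanics
open scoped ENNReal

/-! ## Independence of the hard core of `W` and an event on labels disjoint from `W` -/

/-- **Factorisation**: for an event `E` involving only the labels in `B` and a label set `W` disjoint from `B`,
`ℙ^{⊗}(hardCore(W) ∩ E) = Ξ(W) · ℙ^{⊗}(E)`. [folklore] -/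
theorem pi_hardCore_inter_eq_of_dependsOn (ε : ℝ) {n : ℕ} (W B : Finset (Fin n)) (hWB : Disjoint W B)
    {E : Set (Fin n → T3)} (hE : MeasurableSet E)
    (hdep : ∀ x y : Fin n → T3, (∀ b ∈ B, x b = y b) → (x ∈ E ↔ y ∈ E)) :
    (Measure.pi fun _ : Fin n => (volume : Measure T3)) (hardCoreSet (Ov ε) W ∩ E)
      = ENNReal.ofReal (hcProb (Ov ε) (volume : Measure T3) W) *
          (Measure.pi fun _ : Fin n => (volume : Measure T3)) E := by
  classical
  set P : Measure (Fin n → T3) := Measure.pi fun _ : Fin n => (volume : Measure T3) with hP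
  have hHC : MeasurableSet (hardCoreSet (Ov ε) W : Set (Fin n → T3)) :=
    measurableSet_hardCoreSet (measurableSet_ov ε) W
  have hF : DependsOn (fun x : Fin n → T3 =>
      (hardCoreSet (Ov ε) W : Set (Fin n → T3)).indicator (1 : (Fin n → T3) → ℝ) x) (W : Set (Fin n)) := by
    refine dependsOn_indicator_of_mem_iff fun x y hxy => ?_
    simp only [hardCoreSet, Set.mem_setOf_eq]
    constructor
    · intro h a ha b hb hab; rw [← hxy a ha, ← hxy b hb]; exact h a ha b hb hab
    · intro h a ha b hb hab; rw [hxy a ha, hxy b hb]; exact h a ha b hb hab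
  have hG : DependsOn (fun x : Fin n → T3 => E.indicator (1 : (Fin n → T3) → ℝ) x) (B : Set (Fin n)) :=
    dependsOn_indicator_of_mem_iff hdep
  have hFm : Measurable fun x : Fin n → T3 =>
      (hardCoreSet (Ov ε) W : Set (Fin n → T3)).indicator (1 : (Fin n → T3) → ℝ) x :=
    measurable_one.indicator hHC
  have hGm : Measurable fun x : Fin n → T3 => E.indicator (1 : (Fin n → T3) → ℝ) x :=
    measurable_one.indicator hE
  have hprod := integral_mul_eq_of_dependsOn (volume : Measure T3) hWB hFm hGm hF hG
  have hinter : (hardCoreSet (Ov ε) W ∩ E).indicator (1 : (Fin n → T3) → ℝ)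
      = fun x => (hardCoreSet (Ov ε) W : Set (Fin n → T3)).indicator 1 x * E.indicator 1 x := by
    rw [Set.inter_indicator_one]
    rfl
  have h1 : P.real (hardCoreSet (Ov ε) W ∩ E) = hcProb (Ov ε) (volume : Measure T3) W * P.real E := by
    rw [← integral_indicator_one (hHC.inter hE), hinter, hP, hprod, integral_indicator_one hHC,
      integral_indicator_one hE, hcProb]
  haveI : IsFiniteMeasure P := by rw [hP]; infer_instance
  rw [← ENNReal.ofReal_toReal (measure_ne_top P _), ← measureReal_def, h1,
    ENNReal.ofReal_mul (hcProb_nonneg (volume : Measure T3) W), measureReal_def,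
    ENNReal.ofReal_toReal (measure_ne_top _ _)]

/-! ## The overlap ball and the overlap events of a third label

The **overlap ball** of radius `ε` at the origin is written inline, `{q : T3 | euclidDist q 0 < ε}` (minimal-image distance
`< ε`; no new definition). -/

/-- The overlap ball is measurable (it is open). [folklore] -/
theorem measurableSet_ovBall (ε : ℝ) : MeasurableSet {q : T3 | Literature.Analysis.FluidPDE.Torus.euclidDist q 0 < ε} :=
  (isOpen_lt (continuous_euclidDist_prod.comp (continuous_id.prodMk continuous_const)) continuous_const).measurableSet

/-- Overlap of two labelled points is membership of their difference in the overlap ball. [folklore] -/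
theorem ov_iff_sub_mem_ovBall (ε : ℝ) (a b : T3) :
    Ov ε a b ↔ a - b ∈ {q : T3 | Literature.Analysis.FluidPDE.Torus.euclidDist q 0 < ε} := by
  simp only [Ov, Set.mem_setOf_eq, Literature.Analysis.FluidPDE.Torus.euclidDist_eq, sub_zero]

/-- The overlap ball has Haar measure at most the overlap scale `p_ε = v₁ ε³` (`0 ≤ ε < 1/2`). [folklore] -/
theorem volume_ovBall_le {ε : ℝ} (hε : 0 ≤ ε) (hε2 : ε < 1 / 2) :
    volume {q : T3 | Literature.Analysis.FluidPDE.Torus.euclidDist q 0 < ε} ≤ ENNReal.ofReal (pOv uniformProfile ε) := by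
  have h := μ_ov_le_pOv uniformProfile hε hε2 (0 : T3)
  rw [uniformProfile_μ] at h
  have hset : {y : T3 | Ov ε 0 y} = {q : T3 | Literature.Analysis.FluidPDE.Torus.euclidDist q 0 < ε} := by
    ext y
    simp only [Ov, Set.mem_setOf_eq, Literature.Analysis.FluidPDE.Torus.euclidDist_comm (0 : T3) y]
  rwa [hset] at h

/-! ## Keeping the constraints: the hard core from the pair event and the third-label overlap events -/

/-- **Set inclusion**: let `W = univ ∖ {i, j}` and let `T` lie outside the core (`ε ≤ ‖reprSym q‖` on `T`).  A configuration
whose labels in `W` are mutually compatible, whose pair satisfies `x_i − x_j ∈ T`, and such that no `k ∈ W` overlaps `x_i` or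
`x_j`, is a hard-core configuration of ALL labels. [folklore] -/
theorem hardCore_pair_sdiff_subset (ε : ℝ) {n : ℕ} {i j : Fin n} (hij : i ≠ j) {T : Set T3}
    (hTfar : ∀ q ∈ T, ε ≤ ‖Literature.Analysis.FluidPDE.Torus.reprSym q‖) :
    (hardCoreSet (Ov ε) ((univ : Finset (Fin n)) \ {i, j}) ∩ {x : Fin n → T3 | x i - x j ∈ T}) \
        (⋃ k ∈ ((univ : Finset (Fin n)) \ {i, j}),
          ({x : Fin n → T3 | x k - x i ∈ {q : T3 | Literature.Analysis.FluidPDE.Torus.euclidDist q 0 < ε}} ∪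
            {x | x k - x j ∈ {q : T3 | Literature.Analysis.FluidPDE.Torus.euclidDist q 0 < ε}}))
      ⊆ hardCoreSet (Ov ε) (univ : Finset (Fin n)) ∩ {x | x i - x j ∈ T} := by
  classical
  intro x hx
  simp only [Set.mem_sdiff, Set.mem_inter_iff, Set.mem_setOf_eq, Set.mem_iUnion, Set.mem_union, not_exists,
    not_or, exists_prop, not_and] at hx
  obtain ⟨⟨hW, hE⟩, hU⟩ := hx
  refine ⟨?_, hE⟩
  have hmemW : ∀ a : Fin n, a ≠ i → a ≠ j → a ∈ (univ : Finset (Fin n)) \ {i, j} := by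
    intro a hai haj
    simp [hai, haj]
  -- the pair itself does not overlap
  have hpair : ¬ Ov ε (x i) (x j) := by
    intro hov
    rw [Ov, Literature.Analysis.FluidPDE.Torus.euclidDist_eq] at hov
    exact (not_lt.2 (hTfar _ hE)) hov
  intro a _ b _ hab hov
  by_cases hai : a = i
  · subst hai
    by_cases hbj : b = j
    · subst hbj; exact hpair hov
    · -- b ∈ W overlaps x_i
      have hbW := hmemW b (Ne.symm hab) hbj
      have h2 : Ov ε (x b) (x a) := ov_symm ε _ _ hov
      exact (hU b hbW).1 ((ov_iff_sub_mem_ovBall ε _ _).1 h2)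
  by_cases haj : a = j
  · subst haj
    by_cases hbi : b = i
    · subst hbi; exact hpair (ov_symm ε _ _ hov)
    · have hbW := hmemW b hbi (Ne.symm hab)
      have h2 : Ov ε (x b) (x a) := ov_symm ε _ _ hov
      exact (hU b hbW).2 ((ov_iff_sub_mem_ovBall ε _ _).1 h2)
  -- a ∈ W
  have haW := hmemW a hai haj
  by_cases hbi : b = i
  · subst hbi
    exact (hU a haW).1 ((ov_iff_sub_mem_ovBall ε _ _).1 hov)
  by_cases hbj : b = j
  · subst hbj
    exact (hU a haW).2 ((ov_iff_sub_mem_ovBall ε _ _).1 hov)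
  exact hW a haW b (hmemW b hbi hbj) hab hov

/-! ## The lower bound under the product measure -/

/-- **Keeping the constraints, in measure**: for `i ≠ j`, measurable `T` outside the core,
`Ξ(univ ∖ {i,j}) · vol(T) ≤ ℙ^{⊗}(hardCore(univ) ∩ {x_i − x_j ∈ T})
  + Σ_{k ∉ {i,j}} Ξ(univ ∖ {i,j,k}) · (2 vol(B_ε)) · vol(T)`. [folklore] -/
theorem pi_hardCore_inter_pairEvent_ge (ε : ℝ) {n : ℕ} {i j : Fin n} (hij : i ≠ j) {T : Set T3}
    (hT : MeasurableSet T) (hTfar : ∀ q ∈ T, ε ≤ ‖Literature.Analysis.FluidPDE.Torus.reprSym q‖) :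
    ENNReal.ofReal (hcProb (Ov ε) (volume : Measure T3) ((univ : Finset (Fin n)) \ {i, j})) * volume T
      ≤ (Measure.pi fun _ : Fin n => (volume : Measure T3))
            (hardCoreSet (Ov ε) (univ : Finset (Fin n)) ∩ {x | x i - x j ∈ T}) +
        ∑ k ∈ ((univ : Finset (Fin n)) \ {i, j}),
          ENNReal.ofReal (hcProb (Ov ε) (volume : Measure T3) ((univ : Finset (Fin n)) \ {i, j, k})) *
            (2 * volume {q : T3 | Literature.Analysis.FluidPDE.Torus.euclidDist q 0 < ε} * volume T) := by
  classical
  set O : Set T3 := {q : T3 | Literature.Analysis.FluidPDE.Torus.euclidDist q 0 < ε} with hOdef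
  set P : Measure (Fin n → T3) := Measure.pi fun _ : Fin n => (volume : Measure T3) with hP
  set W : Finset (Fin n) := (univ : Finset (Fin n)) \ {i, j} with hW
  set E : Set (Fin n → T3) := {x | x i - x j ∈ T} with hEdef
  set A : Set (Fin n → T3) := hardCoreSet (Ov ε) W ∩ E with hA
  set Bk : Fin n → Set (Fin n → T3) := fun k =>
    {x : Fin n → T3 | x k - x i ∈ O} ∪ {x | x k - x j ∈ O} with hBk
  have hO : MeasurableSet O := measurableSet_ovBall ε
  have hE : MeasurableSet E := measurableSet_pairEvent i j hT
  -- Step 1: the factorised main term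
  have hmain : P A = ENNReal.ofReal (hcProb (Ov ε) (volume : Measure T3) W) * volume T := by
    rw [hA, hP, pi_hardCore_inter_eq_of_dependsOn ε W {i, j} sdiff_disjoint hE, pi_pairEvent_eq hij hT]
    intro x y hxy
    simp only [hEdef, Set.mem_setOf_eq, hxy i (by simp), hxy j (by simp)]
  -- Step 2: A ⊆ (A \ U) ∪ ⋃ₖ (A ∩ Bk), and A \ U ⊆ hardCore(univ) ∩ E
  have hsplit : A ⊆ (A \ ⋃ k ∈ W, Bk k) ∪ ⋃ k ∈ W, (A ∩ Bk k) := by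
    intro x hx
    by_cases hxU : x ∈ ⋃ k ∈ W, Bk k
    · right
      simp only [Set.mem_iUnion, exists_prop] at hxU ⊢
      obtain ⟨k, hk, hxk⟩ := hxU
      exact ⟨k, hk, hx, hxk⟩
    · left; exact ⟨hx, hxU⟩
  have hdiff : A \ (⋃ k ∈ W, Bk k) ⊆ hardCoreSet (Ov ε) (univ : Finset (Fin n)) ∩ E :=
    hardCore_pair_sdiff_subset ε hij hTfar
  -- Step 3: each third-label term
  have hterm : ∀ k ∈ W, P (A ∩ Bk k) ≤
      ENNReal.ofReal (hcProb (Ov ε) (volume : Measure T3) ((univ : Finset (Fin n)) \ {i, j, k})) *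
        (2 * volume O * volume T) := by
    intro k hk
    have hki : k ≠ i := by intro h; simp [hW, h] at hk
    have hkj : k ≠ j := by intro h; simp [hW, h] at hk
    have hWk : hardCoreSet (Ov ε) W ⊆ (hardCoreSet (Ov ε) ((univ : Finset (Fin n)) \ {i, j, k}) : Set (Fin n → T3)) := by
      intro x hx a ha b hb hab
      have hsub : (univ : Finset (Fin n)) \ {i, j, k} ⊆ W := by
        intro c hc
        simp only [hW, Finset.mem_sdiff, Finset.mem_univ, Finset.mem_insert, Finset.mem_singleton, true_and,
          not_or] at hc ⊢
        exact ⟨hc.1, hc.2.1⟩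
      exact hx a (hsub ha) b (hsub hb) hab
    have hEB : MeasurableSet (E ∩ Bk k) :=
      hE.inter ((measurableSet_pairEvent k i hO).union (measurableSet_pairEvent k j hO))
    have hsub1 : A ∩ Bk k ⊆ hardCoreSet (Ov ε) ((univ : Finset (Fin n)) \ {i, j, k}) ∩ (E ∩ Bk k) := by
      intro x hx; exact ⟨hWk hx.1.1, hx.1.2, hx.2⟩
    have hdepk : ∀ x y : Fin n → T3, (∀ b ∈ ({i, j, k} : Finset (Fin n)), x b = y b) →
        (x ∈ E ∩ Bk k ↔ y ∈ E ∩ Bk k) := by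
      intro x y hxy
      simp only [hEdef, hBk, Set.mem_inter_iff, Set.mem_union, Set.mem_setOf_eq, hxy i (by simp), hxy j (by simp),
        hxy k (by simp)]
    have hfac := pi_hardCore_inter_eq_of_dependsOn ε ((univ : Finset (Fin n)) \ {i, j, k}) {i, j, k}
      sdiff_disjoint hEB hdepk
    -- the independent probability of `E ∩ Bk k`
    have hind : P (E ∩ Bk k) ≤ 2 * volume O * volume T := by
      have h1 : P ({x : Fin n → T3 | x k - x i ∈ O} ∩ E) = volume O * volume T := by
        rw [hP, pi_subEvent_inter_eq hki.symm hO hE, pi_pairEvent_eq hij hT]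
        intro x y
        simp only [hEdef, Set.mem_setOf_eq, Function.update_of_ne hki.symm, Function.update_of_ne hkj.symm]
      have h2 : P ({x : Fin n → T3 | x k - x j ∈ O} ∩ E) = volume O * volume T := by
        rw [hP, pi_subEvent_inter_eq hkj.symm hO hE, pi_pairEvent_eq hij hT]
        intro x y
        simp only [hEdef, Set.mem_setOf_eq, Function.update_of_ne hki.symm, Function.update_of_ne hkj.symm]
      have hsubU : E ∩ Bk k ⊆ ({x : Fin n → T3 | x k - x i ∈ O} ∩ E) ∪ ({x | x k - x j ∈ O} ∩ E) := by
        intro x hx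
        rcases hx.2 with h | h
        · exact Or.inl ⟨h, hx.1⟩
        · exact Or.inr ⟨h, hx.1⟩
      calc P (E ∩ Bk k) ≤ P (({x : Fin n → T3 | x k - x i ∈ O} ∩ E) ∪ ({x | x k - x j ∈ O} ∩ E)) :=
            measure_mono hsubU
        _ ≤ P ({x : Fin n → T3 | x k - x i ∈ O} ∩ E) + P ({x | x k - x j ∈ O} ∩ E) :=
            measure_union_le _ _
        _ = 2 * volume O * volume T := by rw [h1, h2]; ring
    calc P (A ∩ Bk k) ≤ P (hardCoreSet (Ov ε) ((univ : Finset (Fin n)) \ {i, j, k}) ∩ (E ∩ Bk k)) :=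
          measure_mono hsub1
      _ = ENNReal.ofReal (hcProb (Ov ε) (volume : Measure T3) ((univ : Finset (Fin n)) \ {i, j, k})) *
            P (E ∩ Bk k) := by rw [hP, hfac]
      _ ≤ _ := mul_le_mul' le_rfl hind
  -- Step 4: assemble
  calc ENNReal.ofReal (hcProb (Ov ε) (volume : Measure T3) W) * volume T = P A := hmain.symm
    _ ≤ P ((A \ ⋃ k ∈ W, Bk k) ∪ ⋃ k ∈ W, (A ∩ Bk k)) := measure_mono hsplit
    _ ≤ P (A \ ⋃ k ∈ W, Bk k) + P (⋃ k ∈ W, (A ∩ Bk k)) := measure_union_le _ _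
    _ ≤ P (hardCoreSet (Ov ε) (univ : Finset (Fin n)) ∩ E) + ∑ k ∈ W, P (A ∩ Bk k) :=
        add_le_add (measure_mono hdiff) (measure_biUnion_finset_le _ _)
    _ ≤ _ := add_le_add le_rfl (Finset.sum_le_sum hterm)

/-! ## The canonical lower bound -/

/-- **Lower bound for the canonical pair law outside the core.** Under `SmallDensity uniformProfile σ`, for every `N`,
`i ≠ j` and measurable `T ⊆ 𝕋³` with `ε_N ≤ ‖reprSym q‖` on `T`:
`(1 − 16 λ) · vol(T) ≤ posGibbsMeasure 1 (hsDiameter σ N) (N+1) {x_i − x_j ∈ T}`, `λ = ovDensity uniformProfile σ = v₁σ³`.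
Uniform in `N` and `T`; the one-sided contact-scale input of a collision-rate floor at global equilibrium. [folklore] -/
theorem posGibbs_pairEvent_ge {σ : ℝ} (h : SmallDensity uniformProfile σ) {N : ℕ} {i j : Fin (N + 1)} (hij : i ≠ j)
    {T : Set T3} (hT : MeasurableSet T)
    (hTfar : ∀ q ∈ T, hsDiameter σ N ≤ ‖Literature.Analysis.FluidPDE.Torus.reprSym q‖) :
    ENNReal.ofReal (1 - 16 * ovDensity uniformProfile σ) * volume T
      ≤ posGibbsMeasure (fun _ => (1 : ℝ)) (hsDiameter σ N) (N + 1) {x | x i - x j ∈ T} := by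
  classical
  set ε := hsDiameter σ N with hεdef
  set O : Set T3 := {q : T3 | Literature.Analysis.FluidPDE.Torus.euclidDist q 0 < ε} with hOdef
  set P : Measure (Fin (N + 1) → T3) := Measure.pi fun _ : Fin (N + 1) => (volume : Measure T3) with hP
  set W : Finset (Fin (N + 1)) := (univ : Finset (Fin (N + 1))) \ {i, j} with hW
  set lam := ovDensity uniformProfile σ with hlam
  have hσ := h.σ_pos
  have hlam1 := h.ovDensity_lt_one
  have hlam0 : 0 ≤ lam := ovDensity_nonneg hσ.le
  have hε0 : 0 ≤ ε := hsDiameter_nonneg' hσ.le N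
  have hε2 : ε < 1 / 2 := hsDiameter_lt_half hσ.le h.σ_lt_half N
  have hXpos : ∀ m ≤ N + 1, 0 < XiN uniformProfile σ N m := fun m hm => XiN_pos hσ.le h.σ_lt_half hlam1 hm
  have hE : MeasurableSet {x : Fin (N + 1) → T3 | x i - x j ∈ T} := measurableSet_pairEvent i j hT
  -- the canonical measure as `Ξ(univ)⁻¹ ×` the restricted product measure
  rw [posGibbsMeasure_eq continuous_const (fun _ => one_pos) ε (N + 1), Measure.smul_apply, smul_eq_mul,
    Measure.restrict_apply hE, profileOf_one_μ, Xi, firstLabels_self, profileOf_one_μ, Set.inter_comm]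
  -- abbreviations for the hard-core probabilities
  set Xu : ℝ := hcProb (Ov ε) (volume : Measure T3) (univ : Finset (Fin (N + 1))) with hXu
  set Xw : ℝ := hcProb (Ov ε) (volume : Measure T3) W with hXw
  have hXu_eq : Xu = XiN uniformProfile σ N (N + 1) := by
    rw [hXu, XiN, Xi, uniformProfile_μ, firstLabels_self]
  have hXu_pos : 0 < Xu := by rw [hXu_eq]; exact hXpos _ le_rfl
  -- ratio bounds: Ξ(W)/Ξ(univ) ≥ 1 and Ξ(univ ∖ {i,j,k})/Ξ(univ) ≤ 8
  have hratioW : 1 ≤ Xw * Xu⁻¹ := by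
    rw [hXw, hXu, hW, hcProb_sdiff_mul_inv_eq_rN σ ({i, j} : Finset (Fin (N + 1))), card_pair hij]
    exact one_le_rN hσ.le h.σ_lt_half hlam1 le_rfl (by have := Fintype.card_fin (N + 1) ▸ (card_pair hij ▸
      (({i, j} : Finset (Fin (N + 1))).card_le_univ)); omega)
  have hratioK : ∀ k ∈ W, hcProb (Ov ε) (volume : Measure T3) ((univ : Finset (Fin (N + 1))) \ {i, j, k}) * Xu⁻¹ ≤ 8 := by
    intro k hk
    have hki : k ≠ i := by intro h'; simp [hW, h'] at hk
    have hkj : k ≠ j := by intro h'; simp [hW, h'] at hk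
    have hcard : ({i, j, k} : Finset (Fin (N + 1))).card = 3 := by
      rw [card_insert_of_notMem (by simp [hij, hki.symm]), card_pair hkj.symm]
    have h3 : 3 ≤ N + 1 := by
      have := (({i, j, k} : Finset (Fin (N + 1))).card_le_univ)
      rw [Fintype.card_fin, hcard] at this
      exact this
    rw [hXu, hcProb_sdiff_mul_inv_eq_rN σ ({i, j, k} : Finset (Fin (N + 1))), hcard]
    calc rN uniformProfile σ N (N + 1) 3 ≤ 2 ^ 3 := h.rN_le_two_pow le_rfl h3
      _ = 8 := by norm_num
  -- volume of the overlap ball: `≤ λ/(N+1)`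
  have hball : volume O ≤ ENNReal.ofReal (lam / (N + 1 : ℕ)) := by
    have := volume_ovBall_le hε0 hε2
    rwa [hεdef, pOv_hsDiameter] at this
  -- the product-measure inequality
  have hkey := pi_hardCore_inter_pairEvent_ge ε hij hT hTfar
  -- pass to real numbers: everything is finite
  haveI : IsFiniteMeasure P := by rw [hP]; infer_instance
  have hcardW : (W.card : ℝ) ≤ (N + 1 : ℕ) := by
    have := W.card_le_univ
    rw [Fintype.card_fin] at this
    exact_mod_cast this
  -- bound the error sum by `16 λ · Ξ(univ) · vol T`
  have hcomb2 : ∀ {a b : ℝ} (_ : 0 ≤ a) (_ : 0 ≤ b) (w : ℝ≥0∞),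
      ENNReal.ofReal a * (2 * ENNReal.ofReal b * w) = ENNReal.ofReal (2 * a * b) * w := by
    intro a b ha hb w
    rw [ENNReal.ofReal_mul (by positivity), ENNReal.ofReal_mul (by norm_num), ENNReal.ofReal_ofNat]
    ring
  have hsum : ∑ k ∈ W, ENNReal.ofReal (hcProb (Ov ε) (volume : Measure T3) ((univ : Finset (Fin (N + 1))) \ {i, j, k})) *
        (2 * volume O * volume T)
      ≤ ENNReal.ofReal (16 * lam * Xu) * volume T := by
    have hN : (0 : ℝ) < (N + 1 : ℕ) := by positivity
    calc ∑ k ∈ W, ENNReal.ofReal (hcProb (Ov ε) (volume : Measure T3) ((univ : Finset (Fin (N + 1))) \ {i, j, k})) *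
          (2 * volume O * volume T)
        ≤ ∑ k ∈ W, ENNReal.ofReal (8 * Xu) * (2 * ENNReal.ofReal (lam / (N + 1 : ℕ)) * volume T) := by
          refine Finset.sum_le_sum fun k hk => mul_le_mul' ?_ (mul_le_mul' (mul_le_mul' le_rfl hball) le_rfl)
          refine ENNReal.ofReal_le_ofReal ?_
          have := hratioK k hk
          rwa [mul_inv_le_iff₀ hXu_pos] at this
      _ = (W.card : ℝ≥0∞) * (ENNReal.ofReal (2 * (8 * Xu) * (lam / (N + 1 : ℕ))) * volume T) := by
          rw [Finset.sum_const, nsmul_eq_mul, hcomb2 (by positivity) (by positivity)]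
      _ = ENNReal.ofReal ((W.card : ℝ) * (2 * (8 * Xu) * (lam / (N + 1 : ℕ)))) * volume T := by
          rw [← mul_assoc, ENNReal.ofReal_mul (Nat.cast_nonneg _), ENNReal.ofReal_natCast]
      _ ≤ ENNReal.ofReal (16 * lam * Xu) * volume T := by
          refine mul_le_mul' (ENNReal.ofReal_le_ofReal ?_) le_rfl
          calc (W.card : ℝ) * (2 * (8 * Xu) * (lam / (N + 1 : ℕ)))
              = (W.card / (N + 1 : ℕ)) * (16 * lam * Xu) := by field_simp; ring
            _ ≤ 1 * (16 * lam * Xu) := by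
                refine mul_le_mul_of_nonneg_right ((div_le_one hN).2 hcardW) (by positivity)
            _ = 16 * lam * Xu := one_mul _
  -- main term: `Ξ(W) vol T ≥ Ξ(univ) vol T`
  have hmainW : ENNReal.ofReal Xu * volume T ≤ ENNReal.ofReal Xw * volume T := by
    refine mul_le_mul' (ENNReal.ofReal_le_ofReal ?_) le_rfl
    have := hratioW
    rw [le_mul_inv_iff₀ hXu_pos, one_mul] at this
    exact this
  -- combine: Ξ(univ)(1 − 16λ) vol T ≤ P(hardCore univ ∩ E)
  have hcomb : ENNReal.ofReal (Xu * (1 - 16 * lam)) * volume T ≤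
      P (hardCoreSet (Ov ε) (univ : Finset (Fin (N + 1))) ∩ {x | x i - x j ∈ T}) := by
    by_cases hneg : 1 - 16 * lam ≤ 0
    · rw [ENNReal.ofReal_of_nonpos (mul_nonpos_of_nonneg_of_nonpos hXu_pos.le hneg), zero_mul]
      exact zero_le
    push Not at hneg
    have hvolT : volume T ≠ ∞ := measure_ne_top _ _
    have h1 : ENNReal.ofReal Xw * volume T ≤
        P (hardCoreSet (Ov ε) (univ : Finset (Fin (N + 1))) ∩ {x | x i - x j ∈ T}) +
          ENNReal.ofReal (16 * lam * Xu) * volume T := hkey.trans (add_le_add le_rfl hsum)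
    have h2 : ENNReal.ofReal Xu * volume T ≤
        P (hardCoreSet (Ov ε) (univ : Finset (Fin (N + 1))) ∩ {x | x i - x j ∈ T}) +
          ENNReal.ofReal (16 * lam * Xu) * volume T := hmainW.trans h1
    have hsplitXu : ENNReal.ofReal Xu * volume T =
        ENNReal.ofReal (Xu * (1 - 16 * lam)) * volume T + ENNReal.ofReal (16 * lam * Xu) * volume T := by
      rw [← add_mul, ← ENNReal.ofReal_add (by positivity) (by positivity)]
      congr 2; ring
    rw [hsplitXu] at h2
    have hfin : ENNReal.ofReal (16 * lam * Xu) * volume T ≠ ∞ := ENNReal.mul_ne_top ENNReal.ofReal_ne_top hvolT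
    exact (ENNReal.add_le_add_iff_right hfin).1 h2
  -- divide by Ξ(univ)
  calc ENNReal.ofReal (1 - 16 * lam) * volume T
      = ENNReal.ofReal Xu⁻¹ * (ENNReal.ofReal (Xu * (1 - 16 * lam)) * volume T) := by
        by_cases hneg : 1 - 16 * lam ≤ 0
        · rw [ENNReal.ofReal_of_nonpos hneg, ENNReal.ofReal_of_nonpos (mul_nonpos_of_nonneg_of_nonpos hXu_pos.le hneg)]
          simp
        push Not at hneg
        rw [← mul_assoc, ← ENNReal.ofReal_mul (inv_nonneg.2 hXu_pos.le), ← mul_assoc, inv_mul_cancel₀ hXu_pos.ne',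
          one_mul]
    _ ≤ ENNReal.ofReal Xu⁻¹ * P (hardCoreSet (Ov ε) (univ : Finset (Fin (N + 1))) ∩ {x | x i - x j ∈ T}) :=
        mul_le_mul' le_rfl hcomb

/-- **The same bound in the crux's parametrisation.** There is `σ₀ > 0` such that for `0 < σ < σ₀`, all `N`, `i ≠ j` and
measurable `T` with `ε_N ≤ ‖reprSym q‖` on `T`: `vol(T) ≤ 2 · posGibbsMeasure 1 (hsDiameter σ N) (N+1) {x_i − x_j ∈ T}`
(the canonical pair law outside the core is at least HALF the ideal one). [folklore] -/
theorem exists_posGibbs_pairEvent_ge :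
    ∃ σ₀ : ℝ, 0 < σ₀ ∧ ∀ σ : ℝ, 0 < σ → σ < σ₀ → ∀ N : ℕ, ∀ i j : Fin (N + 1), i ≠ j →
      ∀ T : Set T3, MeasurableSet T → (∀ q ∈ T, hsDiameter σ N ≤ ‖Literature.Analysis.FluidPDE.Torus.reprSym q‖) →
        volume T ≤ 2 * posGibbsMeasure (fun _ => (1 : ℝ)) (hsDiameter σ N) (N + 1) {x | x i - x j ∈ T} := by
  obtain ⟨σ₁, hσ₁, hsmall⟩ := exists_smallDensity uniformProfile one_pos
  -- also make `16 λ ≤ 1/2`, i.e. `v₁ σ³ ≤ 1/32`: take `σ ≤ σ₂` with `σ₂³ v₁ ≤ 1/32`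
  have hcont : Filter.Tendsto (fun σ : ℝ => ovDensity uniformProfile σ) (nhds 0) (nhds 0) := by
    have hc : Continuous fun σ : ℝ => ovDensity uniformProfile σ := by unfold ovDensity; fun_prop
    simpa [ovDensity] using hc.tendsto 0
  have hev : ∀ᶠ σ in nhds (0 : ℝ), ovDensity uniformProfile σ < 1 / 32 :=
    hcont (Iio_mem_nhds (by norm_num : (0 : ℝ) < 1 / 32))
  obtain ⟨σ₂, hσ₂, hσ₂prop⟩ : ∃ σ₂ > 0, ∀ σ : ℝ, |σ| < σ₂ → ovDensity uniformProfile σ < 1 / 32 := by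
    rcases Metric.eventually_nhds_iff.1 hev with ⟨δ, hδ, hδprop⟩
    exact ⟨δ, hδ, fun σ hσ => hδprop (by simpa [Real.dist_eq] using hσ)⟩
  refine ⟨min σ₁ σ₂, lt_min hσ₁ hσ₂, ?_⟩
  intro σ hσ hσlt N i j hij T hT hTfar
  have hsd : SmallDensity uniformProfile σ := (hsmall σ hσ (hσlt.trans_le (min_le_left _ _))).1
  have hlam : ovDensity uniformProfile σ < 1 / 32 :=
    hσ₂prop σ (by rw [abs_of_pos hσ]; exact hσlt.trans_le (min_le_right _ _))
  have hmain := posGibbs_pairEvent_ge hsd hij hT hTfar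
  have hhalf : (1 : ℝ) / 2 ≤ 1 - 16 * ovDensity uniformProfile σ := by linarith
  calc volume T = 2 * (ENNReal.ofReal (1 / 2) * volume T) := by
        rw [← mul_assoc, show (2 : ℝ≥0∞) * ENNReal.ofReal (1 / 2) = 1 by
          rw [← ENNReal.ofReal_ofNat, ← ENNReal.ofReal_mul (by norm_num)]; norm_num, one_mul]
    _ ≤ 2 * (ENNReal.ofReal (1 - 16 * ovDensity uniformProfile σ) * volume T) :=
        mul_le_mul' le_rfl (mul_le_mul' (ENNReal.ofReal_le_ofReal hhalf) le_rfl)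
    _ ≤ 2 * posGibbsMeasure (fun _ => (1 : ℝ)) (hsDiameter σ N) (N + 1) {x | x i - x j ∈ T} :=
        mul_le_mul' le_rfl hmain

end Literature.MathematicalPhysics.KineticTheory

end
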